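import Literature.Geometry.Kaehler.HolomorphicLineBundleCechFinite
import Literature.Geometry.Kaehler.HolomorphicLineBundleCechDolbeault
import HarnessLib

/-!
# The Cartan–Serre finiteness theorem for `Ȟ^q(𝔘, 𝒪(L))` in every degree (twisted Cartan–Serre, III)

Layer `Literature/Geometry/Kaehler`. For a cocycle line bundle `L` on a COMPACT complex manifold and
nested Leray data `D : DolbeaultLerayDatum E M` subordinate to the trivialisation of `L` (`fr`,
`hfr`; `HolomorphicLineBundleCechBanach`), the Čech cohomology `Ȟ^q(𝔘₀, 𝒪(L))` of the level-`0`
cover is FINITE-DIMENSIONAL IN EVERY DEGREE `q` (**`DolbeaultLerayDatum.finite_cohomologyL`**;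
degree `1` is `finite_cohomology_oneL` of `HolomorphicLineBundleCechFinite`, by the hand-made
degree-one Leray lemma). H. Cartan, J.-P. Serre (1953); H. Grauert, R. Remmert, *Theorie der
Steinschen Räume* (1977), Kap. VI §4 — by L. Schwartz's method exactly as the tree's scalar
`DolbeaultLerayDatum.finite_cohomology` (all `(p,q)`), with the two Leray inputs now taken, in all
degrees, from the twisted Čech–Dolbeault comparison `FramedCover.cechDolbeaultEquivL` and its
naturality under shrinking (`HolomorphicLineBundleCechDolbeault`):

* `lerayL l q : H^q(A^{0,•}(L), ∂̄_L) ≃ Ȟ^q(𝔘_l, 𝒪(L))` for every level (all finite intersections of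
  a level are chart-convex, hence `∂̄`-acyclic), `lerayL_natural`;
* `exists_clsL_resZL_eq_of_leray` (every class of level `0` is represented by a bounded cocycle
  restricted from level `1`), `exists_resZL_resZL_eq_add_deltaZL_of_leray` /
  `exists_resZL_resZL_eq_of_leray` (controlled solvability), in every degree;
* **`finite_cohomologyL (q) : Module.Finite ℂ (Ȟ^q(𝔘₀, 𝒪(L)))`** by
  `Module.finite_of_compact_restriction` with the degree-generic Banach data `ZbL`, `resZL`
  (compact), `deltaZL`, `clsL` of `HolomorphicLineBundleCechFinite`.

Consumer: `h²(M, L ⊗ 𝒪(mH)) < ∞` on a projective surface, the last finiteness input of the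
dimension count of Serre's théorème A for line cocycles (GAGA n° 16 Lemme 8) through the six-term
tower `NatCochain.exists_finrank_cohomology_zero_pos_of_tower`. Everything is proved; the only
definition is `lerayL`.

## References

* H. Cartan, J.-P. Serre, C. R. Acad. Sci. Paris 237 (1953) 128–130. [CartanSerre1953]
* H. Grauert, R. Remmert, *Theorie der Steinschen Räume* (1977), Kap. VI §4, Einleitung.
  [GrauertRemmert1977]
* C. Voisin, *Hodge Theory and Complex Algebraic Geometry I* (2002), Thm. 4.41. [VoisinHodgeI2002]
-/

noncomputable section

open scoped Manifold ContDiff Topology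
open Set Filter Function Literature.Algebra.Homology Literature.Analysis.OperatorTheory

namespace Literature.Geometry.Kaehler

variable {ι : Type*} {E : Type*} [NormedAddCommGroup E] [NormedSpace ℂ E]
  {M : Type*} [TopologicalSpace M] [ChartedSpace E M]

namespace DolbeaultLerayDatum

variable (D : DolbeaultLerayDatum E M) {L : HolomorphicLineBundle ι E M} (fr : ↥D.s → ι)
  (hfr : ∀ i, D.U 3 i ⊆ L.baseSet (fr i))
  [FiniteDimensional ℂ E] [T2Space M] [CompactSpace M] [IsManifold 𝓘(ℂ, E) ω M] [IsManifold 𝓘(ℝ, E) ∞ M]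

/-! ### The Leray isomorphisms of the levels and their naturality -/

/-- **The Leray isomorphism of level `l` for `𝒪(L)`**: `H^q(A^{0,•}(L), ∂̄_L) ≃ Ȟ^q(𝔘_l, 𝒪(L))`
(`FramedCover.cechDolbeaultEquivL` for the finite `∂̄`-acyclic level-`l` cover).
[cite: GrauertRemmert1977, Kap. VI Einleitung] -/
def lerayL (l : Fin 4) (q : ℕ) :
    NatCochain.Cohomology (R := ℂ) (fun b ↦ HolomorphicLineBundle.TwForms.dbar L b) q ≃ₗ[ℂ]
      (D.framedCover fr hfr l).cohomology q :=
  (D.framedCover fr hfr l).cechDolbeaultEquivL (D.cover l) (fun a J ↦ D.isDolbeaultAcyclic_cechSet 0 l a J) q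

/-- **Naturality of the Leray isomorphisms under restriction of the level** (`l ≤ l'`):
`lerayL l = Ȟ^q(res_{l' → l}) ∘ lerayL l'`. [cite: GrauertRemmert1977, Kap. VI Einleitung] -/
theorem lerayL_natural {l l' : Fin 4} (h : l ≤ l') (q : ℕ)
    (c : NatCochain.Cohomology (R := ℂ) (fun b ↦ HolomorphicLineBundle.TwForms.dbar L b) q) :
    D.lerayL fr hfr l q c =
      NatCochain.Cohomology.map (R := ℂ) (A := fun a ↦ (D.framedCover fr hfr l').Cochain a)
        (A' := fun a ↦ (D.framedCover fr hfr l).Cochain a)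
        (fun a ↦ (D.framedCover fr hfr l').res (D.U l) (D.isOpen l) (D.mono l l' h) a)
        (D.res_deltaD fr hfr h) q (D.lerayL fr hfr l' q c) :=
  (D.framedCover fr hfr l').cechDolbeaultEquivL_natural (D.U l) (D.isOpen l) (D.mono l l' h) (D.cover l') (D.cover l)
    (fun a J ↦ D.isDolbeaultAcyclic_cechSet 0 l' a J) (fun a J ↦ D.isDolbeaultAcyclic_cechSet 0 l a J) q c

/-! ### The two Leray inputs, in every degree -/

set_option maxHeartbeats 800000 in
/-- **Every class of `Ȟ^q(𝔘₀, 𝒪(L))` is the class of a bounded cocycle restricted from level `1`**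
(Leray at level `2`, then restrict the representing cocycle: restriction to a strictly lower level
is bounded). [cite: GrauertRemmert1977, Kap. VI §4.3] -/
theorem exists_clsL_resZL_eq_of_leray (q : ℕ) (c : (D.framedCover fr hfr 0).cohomology q) :
    ∃ y : ↥(D.ZbL fr hfr (show (1 : Fin 4) < 2 by decide) q),
      D.clsL fr hfr (show (0 : Fin 4) < 1 by decide) q (D.resZL fr hfr (show (0 : Fin 4) < 1 by decide)
        (show (1 : Fin 4) < 2 by decide) q y) = c := by
  have h01 : (0 : Fin 4) < 1 := by decide
  have h12 : (1 : Fin 4) < 2 := by decide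
  have h02 : (0 : Fin 4) ≤ 2 := by decide
  set d := (D.lerayL fr hfr 0 q).symm c with hd
  obtain ⟨z, hz⟩ := NatCochain.Cohomology.mk_surjective _ q (D.lerayL fr hfr 2 q d)
  have hzδ : (D.framedCover fr hfr 2).delta q (z : (D.framedCover fr hfr 2).Cochain q) = 0 :=
    (NatCochain.mem_cocycles_iff _).1 z.2
  have hy : (⟨_, D.memℓp_res_of_lt fr hfr h12 q z⟩ : D.BddL fr hfr 1 q) ∈ D.ZbL fr hfr h12 q := by
    rw [mem_ZbL_iff, BddL.val_mk, ← D.res_deltaD fr hfr h12.le, hzδ]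
    exact map_zero _
  refine ⟨⟨_, hy⟩, ?_⟩
  have hc : c = D.lerayL fr hfr 0 q d := by rw [hd, LinearEquiv.apply_symm_apply]
  rw [hc, clsL_apply, D.lerayL_natural fr hfr h02 q d, ← hz, NatCochain.Cohomology.map_mk]
  refine congrArg (NatCochain.Cohomology.mk _ q) (Subtype.ext ?_)
  rw [NatCochain.Cohomology.coe_mapCocycles, coe_toCocycleL, coe_resZL, val_resL, BddL.val_mk]
  exact D.res_resD fr hfr h01.le h12.le q (z : (D.framedCover fr hfr 2).Cochain q)

set_option maxHeartbeats 800000 in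
/-- **Controlled solvability, positive degree**: for a bounded `(k+1)`-cocycle `y` of level `1`
there are a bounded cocycle `x` of level `2` and a bounded `k`-cochain `w` of level `0` with
`res res x = res y + δ w` on level `0` — represent the class of `y` at level `3` (Leray at levels
`3` and `1`: `res ζ - y = δ η` on level `1`), restrict `ζ` to level `2` and `η` to level `0`.
[cite: GrauertRemmert1977, Kap. VI §4.3] -/
theorem exists_resZL_resZL_eq_add_deltaZL_of_leray (k : ℕ)
    (y : ↥(D.ZbL fr hfr (show (1 : Fin 4) < 2 by decide) (k + 1))) :
    ∃ (x : ↥(D.ZbL fr hfr (show (2 : Fin 4) < 3 by decide) (k + 1))) (w : D.BddL fr hfr 0 k),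
      D.resZL fr hfr (show (0 : Fin 4) < 1 by decide) (show (1 : Fin 4) < 2 by decide) (k + 1)
          (D.resZL fr hfr (show (1 : Fin 4) < 2 by decide) (show (2 : Fin 4) < 3 by decide) (k + 1) x) =
        D.resZL fr hfr (show (0 : Fin 4) < 1 by decide) (show (1 : Fin 4) < 2 by decide) (k + 1) y +
          D.deltaZL fr hfr (show (0 : Fin 4) < 1 by decide) k w := by
  have h01 : (0 : Fin 4) < 1 := by decide
  have h12 : (1 : Fin 4) < 2 := by decide
  have h23 : (2 : Fin 4) < 3 := by decide
  have h13 : (1 : Fin 4) ≤ 3 := by decide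
  set d := (D.lerayL fr hfr 1 (k + 1)).symm (D.clsL fr hfr h12 (k + 1) y) with hd
  obtain ⟨z, hz⟩ := NatCochain.Cohomology.mk_surjective _ (k + 1) (D.lerayL fr hfr 3 (k + 1) d)
  have hzδ : (D.framedCover fr hfr 3).delta (k + 1) (z : (D.framedCover fr hfr 3).Cochain (k + 1)) = 0 :=
    (NatCochain.mem_cocycles_iff _).1 z.2
  -- `res_{3 → 1} z - y` is a coboundary of level `1`
  set rz : (D.framedCover fr hfr 1).Cochain (k + 1) :=
    (D.framedCover fr hfr 3).res (D.U 1) (D.isOpen 1) (D.mono 1 3 h13) (k + 1) z with hrz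
  have hrzZ : rz ∈ NatCochain.cocycles (R := ℂ) (fun a ↦ (D.framedCover fr hfr 1).delta a) (k + 1) :=
    (NatCochain.mem_cocycles_iff _).2 (by rw [hrz, ← D.res_deltaD fr hfr h13, hzδ]; exact map_zero _)
  have hcob : rz - (y : D.BddL fr hfr 1 (k + 1)).val ∈
      NatCochain.coboundaries (R := ℂ) (A := fun a ↦ (D.framedCover fr hfr 1).Cochain a)
        (fun a ↦ (D.framedCover fr hfr 1).delta a) (k + 1) := by
    have h1 : D.lerayL fr hfr 1 (k + 1) d = D.clsL fr hfr h12 (k + 1) y := by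
      rw [hd, LinearEquiv.apply_symm_apply]
    have h2 : NatCochain.Cohomology.mk (fun a ↦ (D.framedCover fr hfr 1).delta a) (k + 1) ⟨rz, hrzZ⟩ =
        NatCochain.Cohomology.mk (fun a ↦ (D.framedCover fr hfr 1).delta a) (k + 1) (D.toCocycleL fr hfr h12 (k + 1) y) := by
      rw [D.lerayL_natural fr hfr h13 (k + 1), ← hz, NatCochain.Cohomology.map_mk, clsL_apply] at h1
      exact h1
    exact (NatCochain.Cohomology.mk_eq_mk_iff _ _ _).1 h2
  obtain ⟨η, hη⟩ := (NatCochain.mem_coboundaries_succ_iff _).1 hcob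
  have hx : (⟨_, D.memℓp_res_of_lt fr hfr h23 (k + 1) z⟩ : D.BddL fr hfr 2 (k + 1)) ∈ D.ZbL fr hfr h23 (k + 1) := by
    rw [mem_ZbL_iff, BddL.val_mk, ← D.res_deltaD fr hfr h23.le, hzδ]
    exact map_zero _
  refine ⟨⟨_, hx⟩, ⟨_, D.memℓp_res_of_lt fr hfr h01 k η⟩, ?_⟩
  apply Subtype.ext
  apply BddL.ext
  rw [Submodule.coe_add, BddL.val_add, coe_resZL, coe_resZL, coe_deltaZL, val_resL, val_resL, val_deltaL,
    coe_resZL, val_resL, BddL.val_mk, BddL.val_mk, D.res_resD fr hfr h12.le h23.le, D.res_resD fr hfr h01.le h13,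
    ← D.res_deltaD fr hfr h01.le]
  have e1 : (y : D.BddL fr hfr 1 (k + 1)).val + (D.framedCover fr hfr 1).delta k η = rz := by
    rw [hη]
    exact add_sub_cancel (y : D.BddL fr hfr 1 (k + 1)).val _
  exact ((D.res_resD fr hfr h01.le h13 (k + 1) (z : (D.framedCover fr hfr 3).Cochain (k + 1))).symm.trans
    ((congrArg ((D.framedCover fr hfr 1).res (D.U 0) (D.isOpen 0) (D.mono 0 1 h01.le) (k + 1)) e1.symm).trans
      (map_add _ _ _)))

set_option maxHeartbeats 800000 in
/-- **Controlled solvability in degree `0`**: a bounded `0`-cocycle of level `1` is the restriction of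
a bounded `0`-cocycle of level `2` (no coboundaries in degree `0`). [cite: GrauertRemmert1977, Kap. VI §4.3] -/
theorem exists_resZL_resZL_eq_of_leray (y : ↥(D.ZbL fr hfr (show (1 : Fin 4) < 2 by decide) 0)) :
    ∃ x : ↥(D.ZbL fr hfr (show (2 : Fin 4) < 3 by decide) 0),
      D.resZL fr hfr (show (0 : Fin 4) < 1 by decide) (show (1 : Fin 4) < 2 by decide) 0
          (D.resZL fr hfr (show (1 : Fin 4) < 2 by decide) (show (2 : Fin 4) < 3 by decide) 0 x) =
        D.resZL fr hfr (show (0 : Fin 4) < 1 by decide) (show (1 : Fin 4) < 2 by decide) 0 y := by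
  have h01 : (0 : Fin 4) < 1 := by decide
  have h12 : (1 : Fin 4) < 2 := by decide
  have h23 : (2 : Fin 4) < 3 := by decide
  have h13 : (1 : Fin 4) ≤ 3 := by decide
  set d := (D.lerayL fr hfr 1 0).symm (D.clsL fr hfr h12 0 y) with hd
  obtain ⟨z, hz⟩ := NatCochain.Cohomology.mk_surjective _ 0 (D.lerayL fr hfr 3 0 d)
  have hzδ : (D.framedCover fr hfr 3).delta 0 (z : (D.framedCover fr hfr 3).Cochain 0) = 0 :=
    (NatCochain.mem_cocycles_iff _).1 z.2
  set rz : (D.framedCover fr hfr 1).Cochain 0 :=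
    (D.framedCover fr hfr 3).res (D.U 1) (D.isOpen 1) (D.mono 1 3 h13) 0 z with hrz
  have hrzZ : rz ∈ NatCochain.cocycles (R := ℂ) (fun a ↦ (D.framedCover fr hfr 1).delta a) 0 :=
    (NatCochain.mem_cocycles_iff _).2 (by rw [hrz, ← D.res_deltaD fr hfr h13, hzδ]; exact map_zero _)
  have heq : rz = (y : D.BddL fr hfr 1 0).val := by
    have h1 : D.lerayL fr hfr 1 0 d = D.clsL fr hfr h12 0 y := by
      rw [hd, LinearEquiv.apply_symm_apply]
    have h2 : NatCochain.Cohomology.mk (fun a ↦ (D.framedCover fr hfr 1).delta a) 0 ⟨rz, hrzZ⟩ =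
        NatCochain.Cohomology.mk (fun a ↦ (D.framedCover fr hfr 1).delta a) 0 (D.toCocycleL fr hfr h12 0 y) := by
      rw [D.lerayL_natural fr hfr h13 0, ← hz, NatCochain.Cohomology.map_mk, clsL_apply] at h1
      exact h1
    have h3 := (NatCochain.Cohomology.mk_eq_mk_iff _ _ _).1 h2
    rw [NatCochain.coboundaries_zero, Submodule.mem_bot, sub_eq_zero] at h3
    exact h3
  have hx : (⟨_, D.memℓp_res_of_lt fr hfr h23 0 z⟩ : D.BddL fr hfr 2 0) ∈ D.ZbL fr hfr h23 0 := by
    rw [mem_ZbL_iff, BddL.val_mk, ← D.res_deltaD fr hfr h23.le, hzδ]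
    exact map_zero _
  refine ⟨⟨_, hx⟩, ?_⟩
  apply Subtype.ext
  apply BddL.ext
  rw [coe_resZL, coe_resZL, val_resL, val_resL, coe_resZL, val_resL, BddL.val_mk,
    D.res_resD fr hfr h12.le h23.le, D.res_resD fr hfr h01.le h13]
  exact (D.res_resD fr hfr h01.le h13 0 (z : (D.framedCover fr hfr 3).Cochain 0)).symm.trans
    (congrArg ((D.framedCover fr hfr 1).res (D.U 0) (D.isOpen 0) (D.mono 0 1 h01.le) 0) heq)

/-! ### The finiteness theorem in every degree -/

/-- **The Cartan–Serre finiteness theorem for `𝒪(L)`, all degrees**: for a cocycle line bundle `L`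
on a compact complex manifold and nested Leray data subordinate to its trivialisation, the Čech
cohomology `Ȟ^q(𝔘₀, 𝒪(L))` of the level-`0` cover with coefficients in the sheaf of sections of `L`
is finite-dimensional for every `q` (H. Cartan, J.-P. Serre (1953); Grauert–Remmert (1977), Kap. VI
§4 Endlichkeitssatz — L. Schwartz's theorem `Module.finite_of_compact_restriction` with the Leray
inputs of the twisted Čech–Dolbeault comparison). [cite: CartanSerre1953] -/
theorem finite_cohomologyL (q : ℕ) : Module.Finite ℂ ((D.framedCover fr hfr 0).cohomology q) := by
  have h01 : (0 : Fin 4) < 1 := by decide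
  have h12 : (1 : Fin 4) < 2 := by decide
  have h23 : (2 : Fin 4) < 3 := by decide
  cases q with
  | zero =>
    refine Module.finite_of_compact_restriction (D.resZL fr hfr h12 h23 0) (D.resZL fr hfr h01 h12 0)
      (0 : D.BddL fr hfr 0 0 →L[ℂ] ↥(D.ZbL fr hfr h01 0)) (D.isCompactOperator_resZL fr hfr h12 h23 0) (fun y ↦ ?_)
      (D.clsL fr hfr h01 0) (fun w ↦ by rw [show (0 : D.BddL fr hfr 0 0 →L[ℂ] ↥(D.ZbL fr hfr h01 0)) w = 0 from rfl, map_zero])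
      (D.exists_clsL_resZL_eq_of_leray fr hfr 0)
    obtain ⟨x, hx⟩ := D.exists_resZL_resZL_eq_of_leray fr hfr y
    exact ⟨x, 0, by rw [map_zero, add_zero]; exact hx⟩
  | succ k =>
    exact Module.finite_of_compact_restriction (D.resZL fr hfr h12 h23 (k + 1)) (D.resZL fr hfr h01 h12 (k + 1))
      (D.deltaZL fr hfr h01 k) (D.isCompactOperator_resZL fr hfr h12 h23 (k + 1))
      (D.exists_resZL_resZL_eq_add_deltaZL_of_leray fr hfr k) (D.clsL fr hfr h01 (k + 1)) (D.clsL_deltaZL fr hfr h01 k)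
      (D.exists_clsL_resZL_eq_of_leray fr hfr (k + 1))

/-- **`dim Ȟ^q(𝔘₀, 𝒪(L)) < ∞`** as a `FiniteDimensional` instance-form statement. [cite: CartanSerre1953] -/
theorem finiteDimensional_cohomologyL (q : ℕ) : FiniteDimensional ℂ ((D.framedCover fr hfr 0).cohomology q) :=
  D.finite_cohomologyL fr hfr q

end DolbeaultLerayDatum

end Literature.Geometry.Kaehler

end
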